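import Summits.NavierStokesRegularity.FluidComputer.ClayBlowupLocalZoomData
import Literature.Analysis.FluidPDE.OseenDuhamelLocalEnergyTail
import Literature.Analysis.FluidPDE.HeatCommutatorLipschitzCutoff
import Literature.Analysis.FluidPDE.SpaceTimeRescaling
import HarnessLib

/-!
# Tools for the truncated local zoom of a Clay blow-up: the three-dimensional forms of the
# energy-paid localisation of the Duhamel term and of the heat commutator; rescaled energies

Cell `ns-blowup`, seat `ns-blowup-ecbridge-2` (g11; the E–C endpoint theory seat). LABEL: E–C typing
(KERNEL — no named fact, no new definition). WHAT THIS IS NOT: not Navier–Stokes evidence — pure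
bookkeeping in `ℝ³` of two Literature estimates (`exists_enorm_oseenDuhamel_sub_le_of_eqOn`,
`norm_heatCommutator_le`) with the constants resolved, for the residual bounds of
`ClayBlowupLocalZoomResidual.lean`. Companion memo:
`run/shared/lean/pub/ns-blowup/ecbridge2/ECBRIDGE-2-MEMO-10.md`.

* `rpow_kernel_exponent_three` — `((ρ/2)²)^{−(3+1)/2} = ((ρ/2)⁴)⁻¹`;
* `lintegral_zoom_slice_sq_le` — `∫ ‖M⁻¹ u(t', y₀ + M⁻¹ z)‖² dz ≤ M · 𝓔` (the rescaled energy);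
* `integrable_sq_norm_of_lintegral_le` — from `∫⁻ ‖f‖ₑ² ≤ B < ∞` to `∫ ‖f‖² ≤ B.toReal`;
* `exists_norm_oseenDuhamel_sub_le_of_eqOn_ball` — CONSTANTS FIRST: two bounded fields on
  `(s, t) × ℝ³` agreeing on `B(z, R/4)`, with slice energies `≤ M 𝓔`, have Duhamel terms at `z`
  within `8192 C_K 𝓔 (M/R⁴) (t − s)`;
* `exists_norm_heatCommutator_three_le` — CONSTANTS FIRST, every lag `h > 0`: for a cutoff of
  `B(0, R)` and a field bounded by `m` on `B(0, R)` with `∫ ‖f‖² ≤ 𝓔`, the heat commutator is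
  `≤ (D₁ m / R + D₂ 𝓔/R⁴) √h + 64 h/R²` at every point.

References: Koch–Nadirashvili–Seregin–Šverák, Acta Math. 203 (2009), §6 and §3 (3.7)–(3.8)
[cite: KochNadirashviliSereginSverak2009, §6 (arXiv pp. 11–13)]; Koch–Tataru, Adv. Math. 157 (2001),
(14) [cite: KochTataruAdvMath2001, §3 (14)].
-/

noncomputable section

namespace Summit.NavierStokesRegularity.FluidComputer

open Set MeasureTheory Filter Topology Function Metric Real
open scoped ENNReal NNReal
open Literature.Analysis Literature.Analysis.FluidPDE

namespace ClayBlowup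

/-- The kernel exponent of `exists_enorm_oseenDuhamel_sub_le_of_eqOn` in dimension three:
`((ρ/2)²)^{−(3+1)/2} = ((ρ/2)⁴)⁻¹`. [folklore] -/
theorem rpow_kernel_exponent_three (ρ : ℝ) :
    ((ρ / 2) ^ 2) ^ (-(((Module.finrank ℝ (EuclideanSpace ℝ (Fin 3)) : ℝ) + 1) / 2)) =
      ((ρ / 2) ^ 4)⁻¹ := by
  rw [finrank_euclideanSpace_fin]
  have h : (-((((3 : ℕ) : ℝ) + 1) / 2)) = -(2 : ℝ) := by norm_num
  rw [h, Real.rpow_neg (by positivity), show (2 : ℝ) = ((2 : ℕ) : ℝ) by norm_num,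
    Real.rpow_natCast]
  congr 1
  ring

/-- **The rescaled energy of a zoom slice**: `∫ ‖M⁻¹ u(t', y₀ + M⁻¹ z)‖² dz = M ∫ ‖u(t')‖²` (`M > 0`),
as an inequality against an energy bound. [cite: KochNadirashviliSereginSverak2009, §6 (6.2)] -/
theorem lintegral_zoom_slice_sq_le {M : ℝ} (hM : 0 < M) (t' : ℝ) (y₀ : EuclideanSpace ℝ (Fin 3))
    (u : ℝ → EuclideanSpace ℝ (Fin 3) → EuclideanSpace ℝ (Fin 3)) {E : ℝ≥0∞}
    (hE : ∫⁻ x, ‖u t' x‖ₑ ^ 2 ≤ E) :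
    ∫⁻ z, ‖M⁻¹ • u t' (y₀ + M⁻¹ • z)‖ₑ ^ 2 ≤ ENNReal.ofReal M * E := by
  have hc : 0 < M⁻¹ := inv_pos.2 hM
  have h1 : ∫⁻ z, ‖M⁻¹ • u t' (y₀ + M⁻¹ • z)‖ₑ ^ 2 =
      ‖M⁻¹‖ₑ ^ 2 * ∫⁻ z, ‖u t' (y₀ + M⁻¹ • z)‖ₑ ^ 2 := by
    rw [← lintegral_const_mul' _ _ (ENNReal.pow_ne_top enorm_ne_top)]
    refine lintegral_congr fun z => ?_
    rw [enorm_smul, mul_pow]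
  have h2 := lintegral_comp_space_affine hc y₀ (fun x => ‖u t' x‖ₑ ^ 2)
  rw [finrank_euclideanSpace_fin] at h2
  rw [h1, h2, ← mul_assoc]
  refine mul_le_mul' (le_of_eq ?_) hE
  rw [Real.enorm_eq_ofReal hc.le, ← ENNReal.ofReal_pow hc.le, ← ENNReal.ofReal_mul (by positivity)]
  congr 1
  field_simp

/-- From a finite `∫⁻ ‖f‖ₑ²` for a continuous field: `‖f‖²` is integrable and `∫ ‖f‖² ≤ B.toReal`.
[folklore] -/
theorem integrable_sq_norm_of_lintegral_le {f : EuclideanSpace ℝ (Fin 3) → EuclideanSpace ℝ (Fin 3)}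
    (hf : Continuous f) {B : ℝ≥0∞} (hB : B ≠ ⊤) (h : ∫⁻ y, ‖f y‖ₑ ^ 2 ≤ B) :
    Integrable (fun y => ‖f y‖ ^ 2) ∧ ∫ y, ‖f y‖ ^ 2 ≤ B.toReal := by
  have he : ∀ y, ENNReal.ofReal (‖f y‖ ^ 2) = ‖f y‖ₑ ^ 2 := fun y => by
    rw [ENNReal.ofReal_pow (norm_nonneg _), ofReal_norm]
  have hfi : Integrable (fun y => ‖f y‖ ^ 2) := by
    refine ⟨(hf.norm.pow 2).aestronglyMeasurable, ?_⟩
    rw [hasFiniteIntegral_iff_enorm]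
    have h1 : ∫⁻ y, ‖‖f y‖ ^ 2‖ₑ = ∫⁻ y, ‖f y‖ₑ ^ 2 := by
      refine lintegral_congr fun y => ?_
      rw [Real.enorm_eq_ofReal (sq_nonneg _), he]
    rw [h1]
    exact h.trans_lt (lt_top_iff_ne_top.2 hB)
  refine ⟨hfi, ?_⟩
  have h1 : ENNReal.ofReal (∫ y, ‖f y‖ ^ 2) ≤ B := by
    rw [ofReal_integral_eq_lintegral_ofReal hfi (Eventually.of_forall fun y => sq_nonneg _)]
    exact (le_of_eq (lintegral_congr fun y => he y)).trans h
  have h2 := ENNReal.toReal_mono hB h1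
  rwa [ENNReal.toReal_ofReal (integral_nonneg fun y => sq_nonneg _)] at h2

/-- **The energy-paid localisation of the Duhamel term, three-dimensional real form, constants
first**: there is `C_K > 0` such that two fields, a.e.-strongly measurable and bounded by `N` on
`(s, t) × ℝ³`, which AGREE on the ball `B(z, R/4)` and have slice energies `≤ M 𝓔` (`𝓔 < ∞`), have
Duhamel terms at `z` within `8192 C_K 𝓔 (M / R⁴) (t − s)`
(`exists_enorm_oseenDuhamel_sub_le_of_eqOn` with `ρ = R/4`, evaluated at the centre).
[cite: KochTataruAdvMath2001, §3 (14)] [cite: KochNadirashviliSereginSverak2009, §4 p. 8 (arXiv:0709.3599)] -/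
theorem exists_norm_oseenDuhamel_sub_le_of_eqOn_ball :
    ∃ CK : ℝ, 0 < CK ∧ ∀ {s t N R M : ℝ} {Eu : ℝ≥0∞}
      {v v' : ℝ → EuclideanSpace ℝ (Fin 3) → EuclideanSpace ℝ (Fin 3)} (z : EuclideanSpace ℝ (Fin 3)),
      s < t → 0 ≤ N → 0 < R → 0 < M → Eu ≠ ⊤ →
      AEStronglyMeasurable (uncurry v)
        ((volume : Measure (ℝ × EuclideanSpace ℝ (Fin 3))).restrict (Ioo s t ×ˢ univ)) →
      AEStronglyMeasurable (uncurry v')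
        ((volume : Measure (ℝ × EuclideanSpace ℝ (Fin 3))).restrict (Ioo s t ×ˢ univ)) →
      (∀ σ ∈ Ioo s t, ∀ y, ‖v σ y‖ ≤ N) → (∀ σ ∈ Ioo s t, ∀ y, ‖v' σ y‖ ≤ N) →
      (∀ σ ∈ Ioo s t, ∀ y, y ∈ ball z (R / 4) → v' σ y = v σ y) →
      (∀ σ ∈ Ioo s t, ∫⁻ y, ‖v σ y‖ₑ ^ 2 ≤ ENNReal.ofReal M * Eu) →
      (∀ σ ∈ Ioo s t, ∫⁻ y, ‖v' σ y‖ₑ ^ 2 ≤ ENNReal.ofReal M * Eu) →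
      ‖oseenDuhamel 1 s v v t z - oseenDuhamel 1 s v' v' t z‖ ≤
        8192 * CK * Eu.toReal * (M / R ^ 4) * (t - s) := by
  obtain ⟨CK, hCK, hfar⟩ := exists_enorm_oseenDuhamel_sub_le_of_eqOn (E := EuclideanSpace ℝ (Fin 3))
  refine ⟨CK, hCK, ?_⟩
  intro s t N R M Eu v v' z hst hN hR hM hEu hvm hv'm hvN hv'N hagree hEv hEv'
  have hρ : (0 : ℝ) < R / 4 := by positivity
  have hME : ENNReal.ofReal M * Eu ≠ ⊤ := ENNReal.mul_ne_top ENNReal.ofReal_ne_top hEu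
  have hag : ∀ σ ∈ Ioo s t, ∀ y, (σ ≤ s ∨ y ∈ ball z (R / 4)) → v' σ y = v σ y := by
    intro σ hσ y hy
    rcases hy with hy | hy
    · exact absurd hy (not_le.2 hσ.1)
    · exact hagree σ hσ y hy
  have key := hfar one_pos hst le_rfl hst.le hN hvm hv'm hvN hv'N hρ hag
    (fun σ hσ => hEv σ hσ) (fun σ hσ => hEv' σ hσ) (mem_ball_self (by positivity))
  rw [rpow_kernel_exponent_three] at key
  have hfin : ENNReal.ofReal (2 * CK * ((R / 4 / 2) ^ 4)⁻¹ * (t - s)) * (ENNReal.ofReal M * Eu) ≠ ⊤ :=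
    ENNReal.mul_ne_top ENNReal.ofReal_ne_top hME
  have h1 := ENNReal.toReal_mono hfin key
  rw [toReal_enorm, ENNReal.toReal_mul, ENNReal.toReal_ofReal (by positivity), ENNReal.toReal_mul,
    ENNReal.toReal_ofReal hM.le] at h1
  refine h1.trans (le_of_eq ?_)
  have e : (R / 4 / 2) ^ 4 = R ^ 4 / 4096 := by ring
  rw [e, inv_div]
  ring

/-- **The heat commutator with a cutoff of `B(0, R)`, three-dimensional form, constants first, EVERY
lag**: there are `D₁, D₂ ≥ 0` such that for `h > 0`, every cutoff `χ` of `B(0, R)` (values in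
`[0,1]`, `χ = 0` off `B(0, 3R/4)`, `(4/R)`-Lipschitz, continuous) and every continuous field `f`,
bounded everywhere, bounded by `m` on `B(0, R)`, with `∫ ‖f‖² ≤ 𝓔`:
`‖χ(z) e^{hΔ}f(z) − e^{hΔ}(χ f)(z)‖ ≤ (D₁ m / R + D₂ 𝓔 / R⁴) √h + 64 h / R²` at every `z`
(`norm_heatCommutator_le_all` with `ρ = R/4`, `offDiagonal_factor_le_sqrt`, and `e^{-x} ≤ 1/x`).
[cite: KochNadirashviliSereginSverak2009, §3 (3.7)–(3.8) and proof of Thm 6.2 (arXiv pp. 6, 13)] -/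
theorem exists_norm_heatCommutator_three_le :
    ∃ D₁ D₂ : ℝ, 0 ≤ D₁ ∧ 0 ≤ D₂ ∧ ∀ {h R m M₀ 𝓔 : ℝ} {χ : EuclideanSpace ℝ (Fin 3) → ℝ}
      {f : EuclideanSpace ℝ (Fin 3) → EuclideanSpace ℝ (Fin 3)},
      0 < h → 0 < R → 0 ≤ m → 0 ≤ 𝓔 →
      (∀ y, 0 ≤ χ y ∧ χ y ≤ 1) → (∀ y, 3 * R / 4 ≤ ‖y‖ → χ y = 0) →
      (∀ y z, |χ y - χ z| ≤ 4 / R * ‖y - z‖) → Continuous χ →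
      Continuous f → (∀ y, ‖f y‖ ≤ M₀) → (∀ y, ‖y‖ < R → ‖f y‖ ≤ m) →
      Integrable (fun y => ‖f y‖ ^ 2) → ∫ y, ‖f y‖ ^ 2 ≤ 𝓔 →
      ∀ z, ‖χ z • UnboundedOperators.heatExtension f h z -
          UnboundedOperators.heatExtension (fun y => χ y • f y) h z‖ ≤
        (D₁ * m / R + D₂ * 𝓔 / R ^ 4) * Real.sqrt h + 64 * h / R ^ 2 := by
  obtain ⟨D, hD⟩ : ∃ D : ℝ, D = 2 * (2 : ℝ) ^ (((Module.finrank ℝ (EuclideanSpace ℝ (Fin 3)) : ℝ)) / 2) :=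
    ⟨_, rfl⟩
  have hD0 : 0 ≤ D := by rw [hD]; positivity
  obtain ⟨κ₀, hκ₀⟩ : ∃ κ₀ : ℝ, κ₀ = (4 * π) ^ (-(3 : ℝ) / 2) := ⟨_, rfl⟩
  have hκ₀0 : 0 ≤ κ₀ := by rw [hκ₀]; positivity
  refine ⟨4 * D, 16384 * κ₀, by positivity, by positivity, ?_⟩
  intro h R m M₀ 𝓔 χ f hh hR hm h𝓔 hχ01 hχ0 hχL hχc hfc hfM hfm hfi hfE z
  have hχsupp : ∀ y, χ y ≠ 0 → ‖y‖ < R - R / 4 := by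
    intro y hy
    have : ¬ 3 * R / 4 ≤ ‖y‖ := fun h' => hy (hχ0 y h'); push Not at this; linarith
  have key := norm_heatCommutator_le_all hh (by positivity : (0 : ℝ) < R / 4) hm
    (by positivity : (0 : ℝ) ≤ 4 / R) hχ01 hχL hχsupp hχc hfc hfM hfm hfi hfE z
  have hfin : ((Module.finrank ℝ (EuclideanSpace ℝ (Fin 3)) : ℝ)) = 3 := by
    rw [finrank_euclideanSpace_fin]; norm_num
  have e1 : (4 * π * h) ^ (-((Module.finrank ℝ (EuclideanSpace ℝ (Fin 3)) : ℝ)) / 2) =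
      (4 * π * h) ^ (-(3 : ℝ) / 2) := by rw [hfin]
  have e2 : (4 * π * h) ^ (((Module.finrank ℝ (EuclideanSpace ℝ (Fin 3)) : ℝ)) / 2) =
      (4 * π * h) ^ ((3 : ℝ) / 2) := by rw [hfin]
  rw [← hD, e1, e2] at key
  refine key.trans ?_
  have hK := offDiagonal_factor_le_sqrt hh (by positivity : (0 : ℝ) < R / 4)
  rw [← hκ₀] at hK
  have hπh : 0 < 4 * π * h := by positivity
  -- the pure Gaussian part: `(4πh)^{-3/2} (4πh)^{3/2} = 1` and `e^{-ρ²/(8h)} ≤ 8h/ρ² = 128 h/R²`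
  have hone : (4 * π * h) ^ (-(3 : ℝ) / 2) * (4 * π * h) ^ ((3 : ℝ) / 2) = 1 := by
    rw [← Real.rpow_add hπh]; norm_num
  have hexp : Real.exp (-((R / 4) ^ 2 / (8 * h))) ≤ 128 * h / R ^ 2 := by
    have ha : 0 < (R / 4) ^ 2 / (8 * h) := by positivity
    have hexp' : Real.exp (-((R / 4) ^ 2 / (8 * h))) ≤ ((R / 4) ^ 2 / (8 * h))⁻¹ := by
      rw [Real.exp_neg]
      exact inv_anti₀ ha ((le_add_of_nonneg_right zero_le_one).trans (Real.add_one_le_exp _))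
    refine hexp'.trans (le_of_eq ?_)
    field_simp
    ring
  have hterm1 : D * m * (4 / R) * Real.sqrt h = 4 * D * m / R * Real.sqrt h := by ring
  have hpart1 : (4 * π * h) ^ (-(3 : ℝ) / 2) * Real.exp (-((R / 4) ^ 2 / (8 * h))) *
      ((4 * π * h) ^ ((3 : ℝ) / 2) / 2) ≤ 64 * h / R ^ 2 := by
    have e : (4 * π * h) ^ (-(3 : ℝ) / 2) * Real.exp (-((R / 4) ^ 2 / (8 * h))) *
        ((4 * π * h) ^ ((3 : ℝ) / 2) / 2) =
        ((4 * π * h) ^ (-(3 : ℝ) / 2) * (4 * π * h) ^ ((3 : ℝ) / 2)) *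
          Real.exp (-((R / 4) ^ 2 / (8 * h))) / 2 := by ring
    rw [e, hone, one_mul]
    calc Real.exp (-((R / 4) ^ 2 / (8 * h))) / 2 ≤ (128 * h / R ^ 2) / 2 := by gcongr
      _ = 64 * h / R ^ 2 := by ring
  have hpart2 : (4 * π * h) ^ (-(3 : ℝ) / 2) * Real.exp (-((R / 4) ^ 2 / (8 * h))) * (𝓔 / 2) ≤
      16384 * κ₀ * 𝓔 / R ^ 4 * Real.sqrt h := by
    have hR4 : (R / 4) ^ 4 = R ^ 4 / 256 := by ring
    calc (4 * π * h) ^ (-(3 : ℝ) / 2) * Real.exp (-((R / 4) ^ 2 / (8 * h))) * (𝓔 / 2)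
        ≤ (128 * κ₀ * ((R / 4) ^ 4)⁻¹ * Real.sqrt h) * (𝓔 / 2) :=
          mul_le_mul_of_nonneg_right hK (by positivity)
      _ = 16384 * κ₀ * 𝓔 / R ^ 4 * Real.sqrt h := by rw [hR4, inv_div]; field_simp; ring
  have esplit : (4 * π * h) ^ (-(3 : ℝ) / 2) * Real.exp (-((R / 4) ^ 2 / (8 * h))) *
      (((4 * π * h) ^ ((3 : ℝ) / 2) + 𝓔) / 2) =
      (4 * π * h) ^ (-(3 : ℝ) / 2) * Real.exp (-((R / 4) ^ 2 / (8 * h))) *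
        ((4 * π * h) ^ ((3 : ℝ) / 2) / 2) +
      (4 * π * h) ^ (-(3 : ℝ) / 2) * Real.exp (-((R / 4) ^ 2 / (8 * h))) * (𝓔 / 2) := by ring
  rw [esplit]
  have e3 : (4 * D * m / R + 16384 * κ₀ * 𝓔 / R ^ 4) * Real.sqrt h + 64 * h / R ^ 2 =
      4 * D * m / R * Real.sqrt h + 64 * h / R ^ 2 + 16384 * κ₀ * 𝓔 / R ^ 4 * Real.sqrt h := by ring
  rw [e3]
  linarith only [hterm1, hpart1, hpart2]

end ClayBlowup

end Summit.NavierStokesRegularity.FluidComputer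

end
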